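import Mathlib
import Summits.CriticalPhenomena.PercolationContinuityZ3.Theorems.PercNearOneGluingNoHeavyLowerTailOrientedAntipodalHallSDCert
import Summits.CriticalPhenomena.PercolationContinuityZ3.Theorems.PercNearOneGluingNoHeavyLowerTailOrientedAntipodalHallPairSocket

/-!
# HYBRID certificates (section splits + node certificates) for the Hall count — definition and soundness

Helper file for crux `stmt-CriticalPhenomena-4575` (`NoHeavyLowerTail`, route `PercNearOneGluingNoHeavy`), hull-port seat
`prim-hp-7` (generation 56); `--supports stmt-CriticalPhenomena-4575`.  Defines ONE inductive predicate `HybridCert` and proves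
it sound.  A HYBRID certificate for a family `D` of subsets of `S` with respect to the goods of a pair of labellings `(g, h)`
(`U ⊆ S`, `g U = A`, `h (S \ U) = B`) is a finite tree whose internal nodes are the Ahlswede–Daykin section splits of
`…OrientedAntipodalHallSDCert` (`SDCert.split`: at `e ∈ S` the projected family `{X \ e}` for `(g (insert e ·), h)` and the
doubleton family `{X : e ∉ X, insert e X ∈ D}` for `(g, h (insert e ·))`) and whose leaves are either the trivial leaves of
`SDCert` or NODE CERTIFICATES: ordered two-sided (Marica–Schönheim) certificates for the node's pair labelling, i.e. exactly the
hypotheses of the pair socket `card_le_card_pairGoods_above_of_orderedTwoSided` (`…OrientedAntipodalHallPairSocket`, ranks in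
`ℕ`).  Soundness (`HybridCert.card_le_card_goods`): a certified family has at most as many members as there are goods of
`(g, h)` above its members; SDR form for a single labelling (`HybridCert.exists_injective_good_above`) when every sub-family is
certified.  `SDCert → HybridCert` (`HybridCert.of_sdCert`).  This is the glue 'HYBRID tree ⟹ Hall' asked for in memo
`prim-hp-7/FROM-prim-hp-7-g54-THREE-PETALS.md` §8: with it, CONJECTURE H there (every co-intersecting family of antipodal bads is
HYBRID-certified; 1.1·10⁸ random families and the seven `TS2-CEX-g54.json` families, 0 failures) formally implies the Hall count,
and — applied to all sub-families, which are again co-intersecting — CoI-KLEITMAN.  (prim-hp-7 gen 56, 2026-08-22.)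
-/

namespace Summit.CriticalPhenomena.PercolationContinuityZ3.Theorems

namespace OrientedAntipodalHall

open Finset AntipodalStrongHarris AntipodalStrongHarris.Lab
open scoped FinsetFamily

variable {α : Type*} [DecidableEq α] {k : ℕ}

/-- **HYBRID certificates** for the Hall count of a family `D` of subsets of `S` with respect to the goods of a pair of labellings
`(g, h)`: the three constructors of `SDCert` (`nil`, `leaf`, `split`) plus `cert`, a NODE CERTIFICATE — members `M X`, pseudo-sets
`P`, ranks `ρM, ρP : Finset α → ℕ` such that along the ranks no element of `M(D) ∪ P` is contained in a later one and every
difference is a pseudo-set or a certified co-good of `(g, h)` (`Z ⊆ S`, `h Z = B`, `g (S \ Z) = A`, `Z` disjoint from a member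
of `D`), together with `h ∅ = B`, `g S = A` and `X ⊆ S` for `X ∈ D` (the hypotheses of
`card_le_card_pairGoods_above_of_orderedTwoSided`). -/
inductive HybridCert : Finset α → (Finset α → Lab k) → (Finset α → Lab k) → Finset (Finset α) → Prop
  | nil (S : Finset α) (g h : Finset α → Lab k) : HybridCert S g h ∅
  | leaf (g h : Finset α → Lab k) (D : Finset (Finset α)) (hg : g ∅ = top) (hh : h ∅ = bot) (hD : D ⊆ {∅}) :
      HybridCert ∅ g h D
  | split (S : Finset α) (g h : Finset α → Lab k) (D : Finset (Finset α)) (e : α) (he : e ∈ S)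
      (h₁ : HybridCert (S.erase e) (fun U => g (insert e U)) h (D.image fun X => X.erase e))
      (h₀ : HybridCert (S.erase e) g (fun U => h (insert e U)) (D.filter fun X => e ∉ X ∧ insert e X ∈ D)) :
      HybridCert S g h D
  | cert (S : Finset α) (g h : Finset α → Lab k) (D : Finset (Finset α)) (hh : h ∅ = bot) (hg : g S = top)
      (hDS : ∀ X ∈ D, X ⊆ S) (M : Finset α → Finset α) (P : Finset (Finset α)) (ρM ρP : Finset α → ℕ)
      (hMM : ∀ X ∈ D, ∀ X' ∈ D, X ≠ X' → ρM X ≤ ρM X' → ¬ M X ⊆ M X' ∧ (M X \ M X' ∈ P ∨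
        (M X \ M X' ⊆ S ∧ h (M X \ M X') = bot ∧ g (S \ (M X \ M X')) = top ∧ ∃ Y ∈ D, Disjoint (M X \ M X') Y)))
      (hMP : ∀ X ∈ D, ∀ E ∈ P,
        (ρM X ≤ ρP E → ¬ M X ⊆ E ∧ (M X \ E ∈ P ∨
          (M X \ E ⊆ S ∧ h (M X \ E) = bot ∧ g (S \ (M X \ E)) = top ∧ ∃ Y ∈ D, Disjoint (M X \ E) Y))) ∧
        (ρP E ≤ ρM X → ¬ E ⊆ M X ∧ (E \ M X ∈ P ∨
          (E \ M X ⊆ S ∧ h (E \ M X) = bot ∧ g (S \ (E \ M X)) = top ∧ ∃ Y ∈ D, Disjoint (E \ M X) Y))))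
      (hPP : ∀ E ∈ P, ∀ E' ∈ P, E ≠ E' → ρP E ≤ ρP E' → ¬ E ⊆ E' ∧ (E \ E' ∈ P ∨
        (E \ E' ⊆ S ∧ h (E \ E') = bot ∧ g (S \ (E \ E')) = top ∧ ∃ Y ∈ D, Disjoint (E \ E') Y))) :
      HybridCert S g h D

/-- Every SD-certificate is a HYBRID certificate (one without node certificates). -/
theorem HybridCert.of_sdCert {S : Finset α} {g h : Finset α → Lab k} {D : Finset (Finset α)} (hc : SDCert S g h D) :
    HybridCert S g h D := by
  induction hc with
  | nil S g h => exact HybridCert.nil S g h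
  | leaf g h D hg hh hD => exact HybridCert.leaf g h D hg hh hD
  | split S g h D e he _ _ ih₁ ih₀ => exact HybridCert.split S g h D e he ih₁ ih₀

/-- **Soundness of HYBRID certificates (counting form).**  A certified family `D` of subsets of `S` has at most as many members as
there are goods of `(g, h)` on `S` lying above a member of `D`.  Internal nodes: the Ahlswede–Daykin split of the goods
(`card_filter_goods_ge_sections`); node certificates: the pair socket (ordered Marica–Schönheim). -/
theorem HybridCert.card_le_card_goods {S : Finset α} {g h : Finset α → Lab k} {D : Finset (Finset α)}
    (hc : HybridCert S g h D) :
    (∀ X ∈ D, X ⊆ S) → #D ≤ #{U ∈ S.powerset | g U = top ∧ h (S \ U) = bot ∧ ∃ X ∈ D, X ⊆ U} := by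
  induction hc with
  | nil S g h => intro _; simp
  | leaf g h D hg hh hD =>
      intro _
      exact (SDCert.leaf g h D hg hh hD).card_le_card_goods (fun X hX => by
        rw [mem_singleton.1 (hD hX)])
  | split S g h D e he h₁ h₀ ih₁ ih₀ =>
      intro hDS
      have hDS₁ : ∀ Y ∈ D.image (fun X => X.erase e), Y ⊆ S.erase e := by
        intro Y hY
        obtain ⟨X, hX, rfl⟩ := mem_image.1 hY
        exact erase_subset_erase e (hDS X hX)
      have hDS₀ : ∀ X ∈ D.filter (fun X => e ∉ X ∧ insert e X ∈ D), X ⊆ S.erase e := by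
        intro X hX
        rw [mem_filter] at hX
        intro x hx
        exact mem_erase.2 ⟨fun hxe => hX.2.1 (hxe ▸ hx), hDS X hX.1 hx⟩
      have := card_filter_goods_ge_sections S he g h D
      have e1 := ih₁ hDS₁
      have e0 := ih₀ hDS₀
      beta_reduce at e1 e0
      rw [card_eq_card_doubletons_add_card_image_erase D e]
      omega
  | cert S g h D hh hg hDS M P ρM ρP hMM hMP hPP =>
      intro _
      exact card_le_card_pairGoods_above_of_orderedTwoSided S g h hh hg D hDS M P ρM ρP hMM hMP hPP

/-- **Soundness of HYBRID certificates (SDR form, single labelling).**  If EVERY sub-family of a family `D` of subsets of `S`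
has a HYBRID certificate for `(f, f)` (node certificates are not hereditary, so the hypothesis is stated for all sub-families —
for a co-intersecting family of antipodal bads every sub-family is again one, so Conjecture H supplies it), then Hall's theorem
gives DISTINCT goods above the members: an injective `φ` on `D` with `X ⊆ φ X ⊆ S`, `f (φ X) = A`, `f (S \ φ X) = B`. -/
theorem HybridCert.exists_injective_good_above (S : Finset α) (f : Finset α → Lab k) (D : Finset (Finset α))
    (hDS : ∀ X ∈ D, X ⊆ S) (hc : ∀ D' ⊆ D, HybridCert S f f D') :
    ∃ φ : D → Finset α, Function.Injective φ ∧
      ∀ X : D, (X : Finset α) ⊆ φ X ∧ φ X ⊆ S ∧ f (φ X) = top ∧ f (S \ φ X) = bot := by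
  classical
  let t : D → Finset (Finset α) := fun X =>
    {U ∈ S.powerset | f U = top ∧ f (S \ U) = bot ∧ (X : Finset α) ⊆ U}
  have hHall : ∀ s : Finset D, #s ≤ #(s.biUnion t) := by
    intro s
    set D' : Finset (Finset α) := s.map (Function.Embedding.subtype _) with hD'
    have hD'sub : D' ⊆ D := by
      intro X hX
      obtain ⟨x, -, rfl⟩ := mem_map.mp hX
      exact x.2
    have hcard : #s = #D' := (card_map _).symm
    have hle := (hc D' hD'sub).card_le_card_goods (fun X hX => hDS X (hD'sub hX))
    have hgoods : {U ∈ S.powerset | f U = top ∧ f (S \ U) = bot ∧ ∃ X ∈ D', X ⊆ U} ⊆ s.biUnion t := by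
      intro U hU
      rw [mem_filter, mem_powerset] at hU
      obtain ⟨hUS, hUtop, hUbot, X, hX, hXU⟩ := hU
      obtain ⟨x, hx, rfl⟩ := mem_map.mp hX
      rw [mem_biUnion]
      refine ⟨x, hx, ?_⟩
      simp only [t, mem_filter, mem_powerset]
      exact ⟨hUS, hUtop, hUbot, hXU⟩
    calc #s = #D' := hcard
      _ ≤ #{U ∈ S.powerset | f U = top ∧ f (S \ U) = bot ∧ ∃ X ∈ D', X ⊆ U} := hle
      _ ≤ #(s.biUnion t) := card_le_card hgoods
  obtain ⟨φ, hφinj, hφ⟩ := (all_card_le_biUnion_card_iff_exists_injective t).mp hHall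
  refine ⟨φ, hφinj, fun X => ?_⟩
  have hX := hφ X
  simp only [t, mem_filter, mem_powerset] at hX
  exact ⟨hX.2.2.2, hX.1, hX.2.1, hX.2.2.1⟩

end OrientedAntipodalHall

end Summit.CriticalPhenomena.PercolationContinuityZ3.Theorems
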